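import Summits.Ventures.PercRepro.ProfileGapMonoThresholdWeakAverage
import Summits.Ventures.PercRepro.ProfileGapMonoThresholdTwo

/-!
# PercRepro — THE DELETION COUNTS OF THE THRESHOLD FAMILY (p5, gen 27; `proofs/P5-GM1.md` §26; tools for the
weak averaged step)

The bookkeeping behind `Σ_{z ∈ E} Φ_t(N ∖ z)` at co-rank `2`, written without subtraction, plus three rank tools:
* `rk_union_add_rk_inter_le` — submodularity of the finset rank `rk`;
* `rk_le_rk_erase_add_one`, `mem_coloops_of_rk_erase` — erasing a point drops the rank by at most one, and a point
  whose erasure drops the rank is a coloop;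
* `sum_card_levelSetCoQ_three_delete_add_le` — p10's deletion count of the co-rank-`3` level set
  (`sum_card_levelSetCo_delete_le`) in the untruncated form
  `Σ_z #T(M ∖ z) + Σ_{S ∈ T} #S + Σ_{S ∈ T, ρ(E∖S) = 3} #coloops(E∖S) ≤ #E · #T`, `T = levelSetCoQ M 3 u`;
* `thresholdSum_delete_eq`, `sum_thresholdSum_delete_eq` — `Σ_{z ∈ E} thresholdSum (N ∖ z) q t` reindexed over the
  rank-`(q−1)` sets `B` of `N`, the complement of `B` in `N ∖ z` being `(E ∖ B) ∖ z`;
* `sum_threshold_erase` — the per-set expansion `Σ_{z ∈ X} [t+1 ≤ ρ(X∖z)] ρ(X∖z) = (#X − κ) [t+1 ≤ ρ X] ρ X +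
  κ [t+1 ≤ ρ X − 1] (ρ X − 1)`, `κ = #coloops X` (the pattern of p10's `sum_ite_erase'`).
Nothing here is asserted about the averaged step itself.
-/

open scoped Matroid

namespace PercRepro.Cogirth

open Finset ThmH Skew Shadow Profile

variable {α : Type} [DecidableEq α] {M : Matroid α} [M.Finite]

section Tools

/-- **Submodularity of the finset rank**: `ρ(X ∪ Y) + ρ(X ∩ Y) ≤ ρ(X) + ρ(Y)`. -/
theorem rk_union_add_rk_inter_le (X Y : Finset α) :
    rk M (X ∪ Y) + rk M (X ∩ Y) ≤ rk M X + rk M Y := by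
  have h := M.eRk_submod (X : Set α) (Y : Set α)
  rw [← coe_inter, ← coe_union, ← coe_rk, ← coe_rk, ← coe_rk, ← coe_rk] at h
  have h' : rk M (X ∩ Y) + rk M (X ∪ Y) ≤ rk M X + rk M Y := by exact_mod_cast h
  omega

/-- Erasing one element drops the rank by at most one. -/
theorem rk_le_rk_erase_add_one {X : Finset α} (hX : X ⊆ gr M) {z : α} (hz : z ∈ X) :
    rk M X ≤ rk M (X.erase z) + 1 := by
  have h := rk_insert_eq (hX hz) (X := X.erase z) ((erase_subset _ _).trans hX)
  rw [insert_erase hz] at h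
  split_ifs at h <;> omega

/-- An element whose erasure drops the rank is a coloop. -/
theorem mem_coloops_of_rk_erase {X : Finset α} (hX : X ⊆ gr M) {z : α} (hz : z ∈ X)
    (h : rk M (X.erase z) + 1 = rk M X) : z ∈ coloops M X := by
  by_contra hc
  have := rk_erase_of_notMem_coloops hX hz hc
  omega

/-- `levelSetCoQ M 3 u` is p10's `levelSetCo M u`. -/
theorem levelSetCoQ_three (u : ℕ) : levelSetCoQ M 3 u = levelSetCo M u := rfl

/-- **The deletion count of the co-rank-3 level set, untruncated**:
`Σ_{z ∈ E} #T(M ∖ z) + Σ_{S ∈ T} #S + Σ_{S ∈ T, ρ(E∖S) = 3} #coloops(E∖S) ≤ #E · #T` for `T = levelSetCoQ M 3 u`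
(p10's `sum_card_levelSetCo_delete_le` without the subtractions). -/
theorem sum_card_levelSetCoQ_three_delete_add_le (u : ℕ) :
    ∑ z ∈ gr M, (levelSetCoQ (M ＼ ({z} : Set α)) 3 u).card +
      (∑ S ∈ levelSetCoQ M 3 u, S.card +
        ∑ S ∈ (levelSetCoQ M 3 u).filter (fun S => rk M (gr M \ S) = 3), (coloops M (gr M \ S)).card) ≤
      (gr M).card * (levelSetCoQ M 3 u).card := by
  have h1 : ∑ z ∈ gr M, (levelSetCoQ (M ＼ ({z} : Set α)) 3 u).card =
      ∑ S ∈ levelSetCoQ M 3 u, ((gr M \ S).filter (fun z => 3 ≤ rk M ((gr M \ S).erase z))).card := by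
    simp only [levelSetCoQ_three, levelSetCo_delete_eq_filter, card_eq_sum_ones]
    apply sum_comm'
    intro z S
    simp only [mem_filter, mem_sdiff]
    tauto
  have h2 : ∑ S ∈ (levelSetCoQ M 3 u).filter (fun S => rk M (gr M \ S) = 3), (coloops M (gr M \ S)).card =
      ∑ S ∈ levelSetCoQ M 3 u, (if rk M (gr M \ S) = 3 then (coloops M (gr M \ S)).card else 0) := by
    rw [sum_filter]
  rw [h1, h2, mul_comm, ← smul_eq_mul, ← sum_const, ← sum_add_distrib, ← sum_add_distrib]
  apply sum_le_sum
  intro S hS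
  rw [mem_levelSetCoQ] at hS
  obtain ⟨⟨hSg, _⟩, _⟩ := hS
  have hX : gr M \ S ⊆ gr M := sdiff_subset
  have hc := card_filter_rk_erase_add_coloops_le (M := M) hX
  have hcard : (gr M \ S).card = (gr M).card - S.card := card_sdiff_of_subset hSg
  have hSle : S.card ≤ (gr M).card := card_le_card hSg
  omega

variable {N : Matroid α} [N.Finite]

/-- The threshold demand of `N ∖ z` is the demand of the rank-`(q−1)` sets `B ∌ z` of `N`, with the complement
`(E ∖ B) ∖ z`. -/
theorem thresholdSum_delete_eq (z : α) (q t : ℕ) :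
    thresholdSum (N ＼ ({z} : Set α)) q t =
      ∑ B ∈ (Rq N (q - 1)).filter (fun B => z ∉ B),
        (if t + 1 ≤ rk N ((gr N \ B).erase z) then rk N ((gr N \ B).erase z) else 0) := by
  unfold thresholdSum
  rw [Rq_delete_eq_filter]
  refine sum_congr rfl (fun B _ => ?_)
  have h1 : gr (N ＼ ({z} : Set α)) \ B = (gr N \ B).erase z := by rw [gr_delete', erase_sdiff]
  rw [h1, rk_delete (erase_subset_erase z sdiff_subset)]

/-- **The deletion sum of the threshold demand, reindexed over the sets**:
`Σ_{z ∈ E} thresholdSum (N ∖ z) q t = Σ_{B : ρ(B) = q−1} Σ_{z ∈ E ∖ B} [t+1 ≤ ρ((E∖B)∖z)] · ρ((E∖B)∖z)`. -/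
theorem sum_thresholdSum_delete_eq (q t : ℕ) :
    ∑ z ∈ gr N, thresholdSum (N ＼ ({z} : Set α)) q t =
      ∑ B ∈ Rq N (q - 1), ∑ z ∈ gr N \ B,
        (if t + 1 ≤ rk N ((gr N \ B).erase z) then rk N ((gr N \ B).erase z) else 0) := by
  simp only [thresholdSum_delete_eq]
  apply sum_comm'
  intro z B
  simp only [mem_filter, mem_sdiff]
  tauto

/-- **The per-set expansion of the threshold term**: with `κ = #coloops X`,
`Σ_{z ∈ X} [t+1 ≤ ρ(X∖z)] ρ(X∖z) = (#X − κ) · [t+1 ≤ ρ X] ρ X + κ · [t+1 ≤ ρ X − 1] (ρ X − 1)`. -/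
theorem sum_threshold_erase {X : Finset α} (hX : X ⊆ gr M) (t : ℕ) :
    ∑ z ∈ X, (if t + 1 ≤ rk M (X.erase z) then rk M (X.erase z) else 0) =
      (X.card - (coloops M X).card) * (if t + 1 ≤ rk M X then rk M X else 0) +
        (coloops M X).card * (if t + 1 ≤ rk M X - 1 then rk M X - 1 else 0) := by
  have hKX : coloops M X ⊆ X := coloops_subset X
  rw [← sum_sdiff hKX]
  congr 1
  · rw [sum_congr rfl (fun z hz => by
        rw [rk_erase_of_notMem_coloops hX (sdiff_subset hz) (mem_sdiff.1 hz).2]),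
      sum_const, smul_eq_mul, card_sdiff_of_subset hKX]
  · rw [sum_congr rfl (fun z hz => by
        have h := rk_erase_of_mem_coloops hX hz
        rw [show rk M (X.erase z) = rk M X - 1 by omega]),
      sum_const, smul_eq_mul]

end Tools

end PercRepro.Cogirth
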